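import Mathlib
import Summits.ValiantsHypothesis.ValiantsHypothesis.Theorems.BarrierLeverPartitionMinorsHitByVPHiddenStatesFirstShellAnyH

/-!
# Route BarrierLever — item `PartitionMinorsHitByVP` (stmt-ValiantsHypothesis-19717), line `hidden-states`:
# ★★ SECOND-SHELL IMMOBILE-TOKEN CLASSES OF EVERY BALL `B_t(h)` — all `h`

Helper file (`--supports stmt-ValiantsHypothesis-19717`; cell valiant-natproofs, 𝒟-side door (c), registered line
`Cruxes/PartitionMinorsHitByVP/Lines/hidden_states.lean` v8; prover seat val-np-p6 gen 17).  Closes NO item; definition-free.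

`…SecondShellCells.exists_table_secondShell_CT` (the half `h = 2t+1`) verbatim for every `h`: `U = B_t(h) ∖ {A₁, A₂} ∪ {C₁, C₂}`,
`|A_l| = t`, `|C_l| = t + 1`, `A_l ⊄ C_l`, `A₁ ≠ A₂`, `C₁ ≠ C₂`, and some `z ∈ A₂ ∩ C₂` outside `A₁ ∪ C₁`; the first-shell certificates
are `…FirstShellAnyH.swapTable'_det_ne_zero` (inert blocks of sizes `|A_l ∩ C_l|`, `|(A_l ∪ C_l)ᶜ|`), the cross minor `D_{B − A₁ + C₂}`
vanishes by the trapped token at `z`, and `…SecondShellExchange` composes (memo HOME/val-np-p6/g17/MEMO-valnp6-g17.md §1–3).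
★★ `exists_table_secondShell_CT_anyH`.

HONEST LABEL: conjecture-column cells at the ball sizes `r = |B_t(h)|` (swap distance 2); 19717 stays OPEN; nothing on crux 14610 or VP ≠ VNP.
-/

set_option linter.dupNamespace false

namespace Summit.ValiantsHypothesis.ValiantsHypothesis.Theorems.BarrierLever.HiddenStates

open Finset

noncomputable section

namespace SecondShell

open PathTable

/-- ★★ **SECOND SHELL OF EVERY BALL, IMMOBILE-TOKEN CLASSES.**  For all `h, t`: `|A₁| = |A₂| = t`, `|C₁| = |C₂| = t + 1` in `Fin h`,
`A₁ ⊄ C₁`, `A₂ ⊄ C₂`, `A₁ ≠ A₂`, `C₁ ≠ C₂`, some `z ∈ A₂ ∩ C₂` outside `A₁ ∪ C₁`; then every injective row family ranging in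
`B_t(h) ∖ {A₁, A₂} ∪ {C₁, C₂}` whose columns cover `B_t(h)` is served by a table. -/
theorem exists_table_secondShell_CT_anyH (h t : ℕ) (A₁ A₂ C₁ C₂ : Finset (Fin h))
    (hA₁ : A₁.card = t) (hA₂ : A₂.card = t) (hC₁ : C₁.card = t + 1) (hC₂ : C₂.card = t + 1)
    (h₁ : ¬ A₁ ⊆ C₁) (h₂ : ¬ A₂ ⊆ C₂) (hA : A₁ ≠ A₂) (hC : C₁ ≠ C₂)
    (hz : ∃ z, z ∈ A₂ ∧ z ∈ C₂ ∧ z ∉ A₁ ∧ z ∉ C₁)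
    {r : ℕ} (u cols : Fin r → Finset (Fin h)) (hu : Function.Injective u)
    (hU : ∀ i, ((u i).card ≤ t ∧ u i ≠ A₁ ∧ u i ≠ A₂) ∨ u i = C₁ ∨ u i = C₂)
    (hcols : ∀ J : Finset (Fin h), J.card ≤ t → ∃ kk, cols kk = J) :
    ∃ tx : Option (Fin h) → Fin h → ℂ,
      (Matrix.of fun i kk : Fin r => ∏ a ∈ u i, (tx none a + ∑ q ∈ cols kk, tx (some q) a)).det ≠ 0 := by
  classical
  obtain ⟨z, hzA₂, hzC₂, hzA₁, hzC₁⟩ := hz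
  obtain ⟨k₁, j₁, j₁', hk₁, hkj₁, a1, a2, a3, a4⟩ := swap_sizes A₁ C₁ hA₁ hC₁ h₁
  obtain ⟨k₂, j₂, j₂', hk₂, hkj₂, b1, b2, b3, b4⟩ := swap_sizes A₂ C₂ hA₂ hC₂ h₂
  obtain ⟨e₁, m1, m2, m3, m4⟩ := exists_equiv_four' A₁ C₁ a1 a2 a3 a4
  obtain ⟨e₂, n1, n2, n3, n4⟩ := exists_equiv_four' A₂ C₂ b1 b2 b3 b4
  let N₁ : Fin h → Fin h → ℂ := fun a q => swapTable' e₁ a q - if q = a then 1 else 0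
  let N₂ : Fin h → Fin h → ℂ := fun a q => swapTable' e₂ a q - if q = a then 1 else 0
  have hT10 : tab2 N₁ N₂ ![1, 0] = swapTable' e₁ := by funext a q; simp [tab2, N₁]
  have hT01 : tab2 N₁ N₂ ![0, 1] = swapTable' e₂ := by funext a q; simp [tab2, N₂]
  -- bookkeeping
  set Ball := Finset.univ.filter fun S : Finset (Fin h) => S.card ≤ t with hBall
  set 𝒰 := insert C₁ (insert C₂ ((Ball.erase A₁).erase A₂)) with h𝒰
  have hBA₁ : A₁ ∈ Ball := Finset.mem_filter.2 ⟨Finset.mem_univ _, by omega⟩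
  have hBA₂ : A₂ ∈ Ball := Finset.mem_filter.2 ⟨Finset.mem_univ _, by omega⟩
  have hBC₁ : C₁ ∉ Ball := fun h' => by have := (Finset.mem_filter.1 h').2; omega
  have hBC₂ : C₂ ∉ Ball := fun h' => by have := (Finset.mem_filter.1 h').2; omega
  have h𝒰card : 𝒰.card = Ball.card := card_secondShell_rows Ball hBA₁ hBA₂ hBC₁ hBC₂ hA hC
  have hUmem : ∀ i, u i ∈ 𝒰 := by
    intro i
    rcases hU i with ⟨hc, hne₁, hne₂⟩ | h' | h'
    · refine Finset.mem_insert_of_mem (Finset.mem_insert_of_mem ?_)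
      exact Finset.mem_erase.2 ⟨hne₂, Finset.mem_erase.2 ⟨hne₁, Finset.mem_filter.2 ⟨Finset.mem_univ _, hc⟩⟩⟩
    · rw [h']; exact Finset.mem_insert_self _ _
    · rw [h']; exact Finset.mem_insert_of_mem (Finset.mem_insert_self _ _)
  obtain ⟨hhit, hcolcard⟩ := rows_cover t 𝒰 h𝒰card u cols hu hUmem hcols
  obtain ⟨i₁, hi₁⟩ := hhit C₁ (Finset.mem_insert_self _ _)
  obtain ⟨i₂, hi₂⟩ := hhit C₂ (Finset.mem_insert_of_mem (Finset.mem_insert_self _ _))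
  have hne : i₁ ≠ i₂ := fun h' => hC (by rw [← hi₁, ← hi₂, h'])
  have hball : ∀ R : Finset (Fin h), R.card ≤ t → R ≠ A₁ → R ≠ A₂ → ∃ i, i ≠ i₁ ∧ i ≠ i₂ ∧ u i = R := by
    intro R hR hR₁ hR₂
    obtain ⟨i, hi⟩ := hhit R (Finset.mem_insert_of_mem (Finset.mem_insert_of_mem
      (Finset.mem_erase.2 ⟨hR₂, Finset.mem_erase.2 ⟨hR₁, Finset.mem_filter.2 ⟨Finset.mem_univ _, hR⟩⟩⟩)))
    refine ⟨i, ?_, ?_, hi⟩ <;> (rintro rfl; first | (rw [hi₁] at hi) | (rw [hi₂] at hi)) <;> (rw [← hi] at hR; omega)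
  -- the base enumeration
  let b : Fin r → Finset (Fin h) := Function.update (Function.update u i₁ A₁) i₂ A₂
  have hb₁ : b i₁ = A₁ := by simp only [b, Function.update_of_ne hne, Function.update_self]
  have hb₂ : b i₂ = A₂ := by simp only [b, Function.update_self]
  have hb : ∀ i, i ≠ i₁ → i ≠ i₂ → b i = u i := fun i h1 h2 => by simp only [b, Function.update_of_ne h2, Function.update_of_ne h1]
  have hub : Function.update (Function.update b i₁ C₁) i₂ C₂ = u := by
    funext i
    by_cases h2 : i = i₂
    · subst h2; rw [Function.update_self, hi₂]
    · rw [Function.update_of_ne h2]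
      by_cases h1 : i = i₁
      · subst h1; rw [Function.update_self, hi₁]
      · rw [Function.update_of_ne h1, hb i h1 h2]
  have hbval : ∀ i, i ≠ i₁ → i ≠ i₂ → (b i).card ≤ t ∧ b i ≠ A₁ ∧ b i ≠ A₂ := by
    intro i h1 h2
    rw [hb i h1 h2]
    rcases hU i with h' | h' | h'
    · exact h'
    · exact absurd (hi₁ ▸ h') (fun hh => h1 (hu hh))
    · exact absurd (hi₂ ▸ h') (fun hh => h2 (hu hh))
  have hAu : ∀ i, u i ≠ A₁ ∧ u i ≠ A₂ := by
    intro i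
    rcases hU i with ⟨-, hne₁, hne₂⟩ | h' | h'
    · exact ⟨hne₁, hne₂⟩
    · rw [h']; constructor <;> (intro h''; rw [h''] at hC₁; omega)
    · rw [h']; constructor <;> (intro h''; rw [h''] at hC₂; omega)
  have hbinj : Function.Injective b := by
    refine update_injective _ (update_injective u hu i₁ A₁ fun i => (hAu i).1) i₂ A₂ fun i' => ?_
    by_cases h' : i' = i₁
    · rw [h', Function.update_self]; exact hA
    · rw [Function.update_of_ne h']; exact (hAu i').2
  have hC₁b : ∀ i, b i ≠ C₁ := by
    intro i h'
    by_cases h1 : i = i₁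
    · rw [h1, hb₁] at h'; rw [h'] at hA₁; omega
    by_cases h2 : i = i₂
    · rw [h2, hb₂] at h'; rw [h'] at hA₂; omega
    · rw [hb i h1 h2, ← hi₁] at h'; exact h1 (hu h')
  have hC₂b : ∀ i, b i ≠ C₂ := by
    intro i h'
    by_cases h1 : i = i₁
    · rw [h1, hb₁] at h'; rw [h'] at hA₁; omega
    by_cases h2 : i = i₂
    · rw [h2, hb₂] at h'; rw [h'] at hA₂; omega
    · rw [hb i h1 h2, ← hi₂] at h'; exact h2 (hu h')
  -- the two first-shell certificates
  have hF1 : (mat (tab2 N₁ N₂ ![1, 0]) (Function.update b i₁ C₁) cols).det ≠ 0 := by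
    rw [hT10]
    refine swapTable'_det_ne_zero hk₁ A₁ C₁ e₁ m1 m2 m3 m4 _ cols (update_injective b hbinj i₁ C₁ hC₁b) ?_
      (by rw [hkj₁]; exact hcols)
    intro i
    by_cases hi : i = i₁
    · right; rw [hi, Function.update_self]
    · left
      rw [Function.update_of_ne hi]
      by_cases h2 : i = i₂
      · rw [h2, hb₂]; exact ⟨by omega, Ne.symm hA⟩
      · have := hbval i hi h2; exact ⟨by rw [hkj₁]; exact this.1, this.2.1⟩
  have hF2 : (mat (tab2 N₁ N₂ ![0, 1]) (Function.update b i₂ C₂) cols).det ≠ 0 := by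
    rw [hT01]
    refine swapTable'_det_ne_zero hk₂ A₂ C₂ e₂ n1 n2 n3 n4 _ cols (update_injective b hbinj i₂ C₂ hC₂b) ?_
      (by rw [hkj₂]; exact hcols)
    intro i
    by_cases hi : i = i₂
    · right; rw [hi, Function.update_self]
    · left
      rw [Function.update_of_ne hi]
      by_cases h1 : i = i₁
      · rw [h1, hb₁]; exact ⟨by omega, hA⟩
      · have := hbval i h1 hi; exact ⟨by rw [hkj₂]; exact this.1, this.2.2⟩
  -- the trapped token `z`
  have hZ : ∀ ε, (mat (tab2 N₁ N₂ ε) (Function.update b i₁ C₂) cols).det = 0 := by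
    intro ε
    have hrow₁ : ∀ q, q ≠ z → swapTable' e₁ z q = 0 := by
      intro q hq; by_contra h'
      have := swapTable'_offdiag A₁ C₁ e₁ m1 h' hq
      rw [Finset.mem_sdiff] at this; exact hzC₁ this.1
    have hrow₂ : ∀ q, q ≠ z → swapTable' e₂ z q = 0 := by
      intro q hq; by_contra h'
      have := swapTable'_offdiag A₂ C₂ e₂ n1 h' hq
      rw [Finset.mem_sdiff] at this; exact this.2 hzA₂
    refine det_eq_zero_of_trapped (tab2 N₁ N₂ ε) {z} ?_ t (Function.update b i₁ C₂) cols hcolcard i₁ ?_ ?_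
    · intro a ha q hq
      rw [Finset.mem_singleton] at ha; subst ha
      rw [Finset.mem_singleton]
      by_contra hqa
      apply hq
      simp only [tab2, N₁, N₂, hrow₁ q hqa, hrow₂ q hqa, if_neg hqa]
      ring
    · rw [Function.update_self]
      exact ⟨z, Finset.mem_inter.2 ⟨hzC₂, Finset.mem_singleton_self z⟩⟩
    · intro R hR hRz
      obtain ⟨x, hx⟩ := hRz
      rw [Finset.mem_inter, Finset.mem_singleton] at hx
      obtain ⟨hxR, rfl⟩ := hx
      have hR₁ : R ≠ A₁ := fun h' => hzA₁ (h' ▸ hxR)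
      by_cases hR₂ : R = A₂
      · refine ⟨i₂, Ne.symm hne, ?_⟩
        rw [Function.update_of_ne (Ne.symm hne), hb₂, hR₂]
      · obtain ⟨i, hi1, hi2, hi⟩ := hball R hR hR₁ hR₂
        exact ⟨i, hi1, by rw [Function.update_of_ne hi1, hb i hi1 hi2, hi]⟩
  obtain ⟨tx, htx⟩ := exists_table_of_cross_zero N₁ N₂ b cols hne C₁ C₂ hF1 hF2 (Or.inl hZ)
  exact ⟨tx, by rw [hub] at htx; exact htx⟩

end SecondShell

end

end Summit.ValiantsHypothesis.ValiantsHypothesis.Theorems.BarrierLever.HiddenStates
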